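import Summits.NavierStokesRegularity.TurbBounds.ShearTailSeq
import Summits.NavierStokesRegularity.TurbBounds.ShearSpecQFormsTF
import HarnessLib

/-!
# The two-field (plane Couette / RB) tail lemma at the coefficient-sequence level, generic in `(N, P)` (rbsdp SPEC 3.4–3.6), as TABLE FORMS

Cell `turb-bounds` (pub-turb), shear lane, pub-turb-shear gen 6 (2026-08-22); v2 lane. With `LW = N+P+3`, `LT = N+P+2`, the ladders `c → a → b` (`W_xx → W_x → W`,
walls at `−1`) and `d → e` (`Θ_x → Θ`), and windows of length `L ≥ P` from the first untracked index:
* `tailT_bound` : `Σ_{k<L} w_{N+1+k} e² ≤ dᵀGT0d + dᵀ·diag(HT)·d + λ_T·Σ_{k<L} w_{LT+k} d²` (`λ_T = lam (N+P)`; SPEC 3.6 first line);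
* `tailW_bound` : `Σ_{k<L} w_{N+1+k} b² ≤ cᵀGW0c + cᵀHWc + λ_W·Σ_{k<L} w_{LW+k} c²` (`λ_W = lam(N+P)·lam(N+P+1)`; SPEC 3.6 second line);
  the forms are those of `ShearSpecQFormsTF` (`qform_gt0Tab`, `qform_gw0Tab`, `qform_hwTab`, `qform_diagMat (htDiag)`) via the two-field ladder dictionary,
  and `lamT_cast`/`lamW_cast` identify `λ_T, λ_W` with the RULE's `ShearTailRule.lamT/lamW` (= the rows' `TailSlack` data).
Built on `ShearTailSeq.window_tail_bound` (two applications for `W`, one for `Θ`). PURE ALGEBRA.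
HONEST FRAMING: rigorous bounds for the stated PDE and boundary conditions; no claim about physical turbulence beyond the bound.
-/

set_option linter.style.longLine false

namespace Summit.NavierStokesRegularity.TurbBounds.ShearSpecPiecesTF

open Finset Summit.NavierStokesRegularity.TurbBounds.LadderTail Summit.NavierStokesRegularity.TurbBounds.ShearTailSeq
  Summit.NavierStokesRegularity.TurbBounds.ShearSpecPieces

/-! ### the weights `omega` as `phi`/`chi` -/

/-- `omega J j = [J ≤ j+1]·φ_j + [J+1 ≤ j]·χ_j` (cast). -/
theorem omega_cast (J j : ℕ) : ((omega J j : ℚ) : ℝ) = (if J ≤ j + 1 then phi j else 0) + (if J + 1 ≤ j then chi j else 0) := by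
  unfold omega phi chi; push_cast; split_ifs <;> simp

/-- `lamAdj J = LadderTail.lam (J − 1)` for `J ≥ 1`, in the form `lamAdj (J+1) = lam J`. -/
theorem lamAdj_cast (J : ℕ) : ((lamAdj (J + 1) : ℚ) : ℝ) = lam J := by
  unfold lamAdj omega lam
  have h1 : J + 1 ≤ J + 1 + 1 + 1 := by omega
  have h2 : J + 1 + 1 ≤ J + 1 + 1 := le_refl _
  rw [if_pos h1, if_pos h2]
  push_cast
  have ha : (2 * ((J : ℝ) + 1 + 1) + 1) ≠ 0 := by positivity
  have hb : (2 * ((J : ℝ) + 1 + 1) + 3) ≠ 0 := by positivity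
  have hc : (2 * ((J : ℝ) + 1 + 1) - 1) ≠ 0 := by
    have : (2 * ((J : ℝ) + 1 + 1) - 1) = 2 * (J : ℝ) + 3 := by ring
    rw [this]; positivity
  have hd : (2 * (J : ℝ) + 3) ≠ 0 := by positivity
  have he : (2 * (J : ℝ) + 7) ≠ 0 := by positivity
  field_simp
  ring

/-- `λ_T = lam (N+P)` (SPEC 3.6). -/
theorem tfLamT_cast (N P : ℕ) : ((tfLamT N P : ℚ) : ℝ) = lam (N + P) := by
  unfold tfLamT; rw [show N + P + 1 = (N + P) + 1 by ring]; exact lamAdj_cast _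

/-- `μ_W = lam (N+P)`. -/
theorem tfMuW_cast (N P : ℕ) : ((tfMuW N P : ℚ) : ℝ) = lam (N + P) := by
  unfold tfMuW; rw [show N + P + 1 = (N + P) + 1 by ring]; exact lamAdj_cast _

/-- `λ_W = lam (N+P) · lam (N+P+1)`. -/
theorem tfLamW_cast (N P : ℕ) : ((tfLamW N P : ℚ) : ℝ) = lam (N + P) * lam (N + P + 1) := by
  unfold tfLamW; push_cast; rw [tfMuW_cast, show N + P + 2 = (N + P + 1) + 1 by ring, lamAdj_cast]

/-- The RULE's `ShearTailRule.lamT/lamW` are the same numbers (cast). -/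
theorem lamT_rule_cast (N P : ℕ) : ((ShearTailRule.lamT N P : ℚ) : ℝ) = lam (N + P) := by
  unfold ShearTailRule.lamT lam; push_cast; ring

/-- See `lamT_rule_cast`. -/
theorem lamW_rule_cast (N P : ℕ) : ((ShearTailRule.lamW N P : ℚ) : ℝ) = lam (N + P) * lam (N + P + 1) := by
  unfold ShearTailRule.lamW lam; push_cast; ring

/-! ### the Θ tail -/

/-- **SPEC 3.6, Θ line** (sequence level): for the ladder `d → e` (`Θ = ∫Θ_x`, `Θ(−1) = 0`) and `P ≤ L`:
`Σ_{k<L} w_{N+1+k} e_{N+1+k}² ≤ Σ_{k<P} w_{N+1+k} e_{N+1+k}² + (φ_{N+P} d_{N+P}² + φ_{N+P+1} d_{N+P+1}²) + lam(N+P)·Σ_{k<L} w_{N+P+2+k} d_{N+P+2+k}²`. -/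
theorem tailT_seq {d e : ℕ → ℝ} (hE : IsLadder d e) (N P L : ℕ) (hL : P ≤ L) :
    ∑ k ∈ range L, w (N + 1 + k) * e (N + 1 + k) ^ 2
      ≤ ∑ k ∈ range P, w (N + 1 + k) * e (N + 1 + k) ^ 2 + (phi (N + P) * d (N + P) ^ 2 + phi (N + P + 1) * d (N + P + 1) ^ 2)
        + lam (N + P) * ∑ k ∈ range L, w (N + P + 2 + k) * d (N + P + 2 + k) ^ 2 := by
  rw [show L = P + (L - P) by omega, Finset.sum_range_add]
  have hw := window_tail_bound hE (N + P) 0 (L - P)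
  simp only [sum_range_zero, add_zero] at hw
  have e1 : ∀ k, N + 1 + (P + k) = N + P + 1 + k := fun k => by omega
  simp only [e1]
  have hpeel : ∑ k ∈ range (0 + 2), phi (N + P + k) * d (N + P + k) ^ 2 = phi (N + P) * d (N + P) ^ 2 + phi (N + P + 1) * d (N + P + 1) ^ 2 := by
    simp [sum_range_succ]
  rw [hpeel] at hw
  have hext : ∑ k ∈ range (L - P), w (N + P + 2 + k) * d (N + P + 2 + k) ^ 2 ≤ ∑ k ∈ range (P + (L - P)), w (N + P + 2 + k) * d (N + P + 2 + k) ^ 2 :=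
    sum_le_sum_of_subset_of_nonneg (range_subset_range.mpr (by omega)) fun k _ _ => mul_nonneg (w_pos _).le (sq_nonneg _)
  have hl : 0 ≤ lam (N + P) := (lam_pos _).le
  nlinarith [hw, mul_le_mul_of_nonneg_left hext hl]

/-! ### the W tail -/

/-- **SPEC 3.6, W line** (sequence level): for the ladders `c → a → b` and `P ≤ L`:
`Σ_{k<L} w_{N+1+k} b² ≤ Σ_{k<P} w_{N+1+k} b² + (φ_{N+P}a_{N+P}² + φ_{N+P+1}a_{N+P+1}²) + lam(N+P)·(φ_{N+P+1}c_{N+P+1}² + φ_{N+P+2}c_{N+P+2}²)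
 + lam(N+P)·lam(N+P+1)·Σ_{k<L} w_{N+P+3+k} c²`. -/
theorem tailW_seq {c a b : ℕ → ℝ} (hA : IsLadder c a) (hB : IsLadder a b) (N P L : ℕ) (hL : P ≤ L) :
    ∑ k ∈ range L, w (N + 1 + k) * b (N + 1 + k) ^ 2
      ≤ ∑ k ∈ range P, w (N + 1 + k) * b (N + 1 + k) ^ 2 + (phi (N + P) * a (N + P) ^ 2 + phi (N + P + 1) * a (N + P + 1) ^ 2)
        + lam (N + P) * (phi (N + P + 1) * c (N + P + 1) ^ 2 + phi (N + P + 2) * c (N + P + 2) ^ 2)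
        + lam (N + P) * lam (N + P + 1) * ∑ k ∈ range L, w (N + P + 3 + k) * c (N + P + 3 + k) ^ 2 := by
  rw [show L = P + (L - P) by omega, Finset.sum_range_add]
  -- step 1: tail of b from N+P+1 by a
  have h1 := window_tail_bound hB (N + P) 0 (L - P)
  simp only [sum_range_zero, add_zero] at h1
  have hpeel1 : ∑ k ∈ range (0 + 2), phi (N + P + k) * a (N + P + k) ^ 2 = phi (N + P) * a (N + P) ^ 2 + phi (N + P + 1) * a (N + P + 1) ^ 2 := by
    simp [sum_range_succ]
  rw [hpeel1] at h1
  -- step 2: tail of a from N+P+2 by c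
  have h2 := window_tail_bound hA (N + P + 1) 0 (L - P)
  simp only [sum_range_zero, add_zero] at h2
  have hpeel2 : ∑ k ∈ range (0 + 2), phi (N + P + 1 + k) * c (N + P + 1 + k) ^ 2 = phi (N + P + 1) * c (N + P + 1) ^ 2 + phi (N + P + 2) * c (N + P + 2) ^ 2 := by
    simp [sum_range_succ, show N + P + 1 + 1 = N + P + 2 by omega]
  rw [hpeel2] at h2
  have e1 : ∀ k, N + 1 + (P + k) = N + P + 1 + k := fun k => by omega
  have e2 : ∀ k, N + P + 1 + 1 + k = N + P + 2 + k := fun k => by omega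
  have e3 : ∀ k, N + P + 1 + 2 + k = N + P + 3 + k := fun k => by omega
  simp only [e1] 
  simp only [e2, e3] at h2
  have hext : ∑ k ∈ range (L - P), w (N + P + 3 + k) * c (N + P + 3 + k) ^ 2 ≤ ∑ k ∈ range (P + (L - P)), w (N + P + 3 + k) * c (N + P + 3 + k) ^ 2 :=
    sum_le_sum_of_subset_of_nonneg (range_subset_range.mpr (by omega)) fun k _ _ => mul_nonneg (w_pos _).le (sq_nonneg _)
  have hl0 : 0 ≤ lam (N + P) := (lam_pos _).le
  have hl1 : 0 ≤ lam (N + P + 1) := (lam_pos _).le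
  have h12 := mul_le_mul_of_nonneg_left h2 hl0
  have h3 := mul_le_mul_of_nonneg_left hext (mul_nonneg hl0 hl1)
  nlinarith [h1, h12, h3]

end Summit.NavierStokesRegularity.TurbBounds.ShearSpecPiecesTF
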